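import Mathlib

/-!
# `MatrixDescartes` (stmt-ValiantsHypothesis-18050) — THE GRAM DUALITY for two-sided words with a
# non-degenerate pivot: `det (X^e J + V·diag(X^{δ})·Vᵀ)` versus `det (diag(X^{E−δ}) + X^{E−e}·VᵀJ⁻¹V)`

HONEST FRAMING.  Cell `pub-symmetroid`, seat `val-sym-mdr-p2` (gen 19); helper file `--supports` the crux
`Theses.LacunarySymmetroid.MatrixDescartes` (OPEN), NO closure claim.  A structure theorem for the crux's
universal class of pivot pencils (`Cruxes/MatrixDescartes/Lines/Lift.lean`: one real symmetric pivot `J` at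
exponent `e`, positive semidefinite letters at arbitrary exponents on both sides), here with the PSD part in
COLUMN (Gram) form `V · diag(X^{δ j}) · Vᵀ = ∑ⱼ X^{δ j} vⱼvⱼᵀ` (`V` any real `ι × ρ` matrix, `vⱼ` its columns,
repeated exponents allowed — every family of PSD letters `Pₖ = BₖᵀBₖ` is of this form) and a NON-DEGENERATE
pivot (`det J ≠ 0`; no sign or index hypothesis).  Nothing here bears on the crux in its window, on
`stub_twoSided`, on `DoorA26` / `DoorA34`, on the cell's registers, or on `VP ≠ VNP`.

**THEOREM (`X_pow_mul_det_word`, the Gram duality).**  For every finite index types `ι` (size `m`) and `ρ`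
(`R` columns), every real `J` with `det J ≠ 0`, every real `V : ι × ρ`, all exponents `e, δ j ≤ E`:

  `X^{E·R} · det (X^e J + V diag(X^{δ}) Vᵀ) = det J · X^{e·m + Σ δ} · det (diag(X^{E − δ j}) + X^{E−e} · (VᵀJ⁻¹V))`

in `ℝ[X]`.  The DUAL WORD `diag(X^{E−δ j}) + X^{E−e}·C` is again a lacunary symmetric pencil: its letters are the
COORDINATE PROJECTORS (one diagonal `0/1` letter per distinct column exponent, exponents reversed) and ONE constant
letter, the `J⁻¹`-GRAM MATRIX `C = VᵀJ⁻¹V` of the letter columns, at the reversed pivot exponent.  Hence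
(`det_word_eq_zero_iff`, `posRoots_word_eq`, `nonzeroRoots_word_eq`): the two determinants vanish identically
together, and otherwise have the SAME non-zero real zeros — in particular the same number `Z₊` of distinct
positive zeros (`card_posRoots_word_eq`).  READING: the PSD letters of a two-sided word interact only through the
Gram matrix `C` of their columns in the indefinite metric `J⁻¹`; size `m` with `R` letter columns is exchanged
for size `R` with a pivot of rank `≤ m` (and `C` has at most the inertia of `J`).  First consequences in this
file: `posRoots_eq_empty_of_gram_eq_zero` — a `J⁻¹`-NULL letter system (`VᵀJ⁻¹V = 0`: all columns isotropic and
pairwise orthogonal for `J⁻¹`) carries NO positive zero, whatever the exponents; the companion files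
`…GramDualSplitting` (letter groups with `J⁻¹`-orthogonal ranges are ADDITIVE) and `…GramDualFrame` use the same
identity.

PROOF.  Pointwise at `x ≠ 0` (`det_word_mul_eq`): `x^eJ + VDVᵀ = J·(x^e·1 + J⁻¹VDVᵀ)`; Sylvester's
`det(1 + AB) = det(1 + BA)` (Mathlib `Matrix.det_one_add_mul_comm`) in the scaled form
`c^R det(c·1_ι + AB) = c^m det(c·1_ρ + BA)` (`sylvester_scaled`) with `A = J⁻¹VD`, `B = Vᵀ` turns
`det(x^e·1 + J⁻¹VDVᵀ)` into `det(x^e·1_ρ + CD)`, and `(diag(x^{E−δ}) + x^{E−e}C)·D = x^{E−e}·(x^e·1 + CD)`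
with `det D = x^{Σδ}`; then two real polynomials agreeing off `0` are equal
(`Polynomial.eq_of_infinite_eval_eq`).  Elementary; axioms `propext`, `Classical.choice`, `Quot.sound`.
[folklore] (Sylvester's determinant identity / the «capacitance matrix» of a low-rank update; the lacunary-pencil
reading is this seat's.)
-/

-- layout Summits/ValiantsHypothesis/ValiantsHypothesis forces the duplicated namespace component
set_option linter.dupNamespace false

namespace Summit.ValiantsHypothesis.ValiantsHypothesis.Theorems.LacunarySymmetroidMatrixDescartes

open Polynomial Matrix Finset
open scoped BigOperators

namespace GramDual

variable {ι ρ : Type*} [Fintype ι] [DecidableEq ι] [Fintype ρ] [DecidableEq ρ]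

/-- the primal word `X^e • J + V · diag(X^{δ j}) · Vᵀ` over `ℝ[X]` (file-local notation) -/
local notation3 (prettyPrint := false) "𝔽[" e ", " J ", " V ", " δ "]" =>
  (((Polynomial.X : Polynomial ℝ) ^ (e : ℕ)) • (J : Matrix _ _ ℝ).map Polynomial.C
    + (V : Matrix _ _ ℝ).map Polynomial.C * Matrix.diagonal (fun j => (Polynomial.X : Polynomial ℝ) ^ (δ j : ℕ))
      * ((V : Matrix _ _ ℝ).map Polynomial.C)ᵀ)

/-- the dual word `diag(X^{E − δ j}) + X^{E−e} • (VᵀJ⁻¹V)` over `ℝ[X]` (file-local notation) -/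
local notation3 (prettyPrint := false) "𝔻[" E ", " e ", " J ", " V ", " δ "]" =>
  (Matrix.diagonal (fun j => (Polynomial.X : Polynomial ℝ) ^ ((E : ℕ) - δ j))
    + ((Polynomial.X : Polynomial ℝ) ^ ((E : ℕ) - (e : ℕ))) •
      ((V : Matrix _ _ ℝ)ᵀ * (J : Matrix _ _ ℝ)⁻¹ * (V : Matrix _ _ ℝ)).map Polynomial.C)

/-! ## §1  Real-matrix algebra: scaled Sylvester and the pointwise duality -/

omit [DecidableEq ι] [DecidableEq ρ] in
/-- **Scaled Sylvester identity**: `c^R · det(c·1_ι + A B) = c^m · det(c·1_ρ + B A)` for `c ≠ 0`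
(`A : ι × ρ`, `B : ρ × ι`, `m = card ι`, `R = card ρ`). [folklore] -/
theorem sylvester_scaled [DecidableEq ι] [DecidableEq ρ] (A : Matrix ι ρ ℝ) (B : Matrix ρ ι ℝ) {c : ℝ}
    (hc : c ≠ 0) :
    c ^ Fintype.card ρ * (c • (1 : Matrix ι ι ℝ) + A * B).det
      = c ^ Fintype.card ι * (c • (1 : Matrix ρ ρ ℝ) + B * A).det := by
  have h1 : c • (1 : Matrix ι ι ℝ) + A * B = c • ((1 : Matrix ι ι ℝ) + (c⁻¹ • A) * B) := by
    rw [smul_add, Matrix.smul_mul, smul_smul, mul_inv_cancel₀ hc, one_smul]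
  have h2 : c • (1 : Matrix ρ ρ ℝ) + B * A = c • ((1 : Matrix ρ ρ ℝ) + B * (c⁻¹ • A)) := by
    rw [smul_add, Matrix.mul_smul, smul_smul, mul_inv_cancel₀ hc, one_smul]
  rw [h1, h2, Matrix.det_smul, Matrix.det_smul, Matrix.det_one_add_mul_comm]
  ring

/-- **Pointwise Gram duality** (`x ≠ 0`): `x^{E R}·det(x^e J + V D Vᵀ) = det J · x^{e m + Σδ} ·
det(diag(x^{E−δ}) + x^{E−e}·VᵀJ⁻¹V)`, `D = diag(x^{δ j})`. [folklore] -/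
theorem det_word_mul_eq (J : Matrix ι ι ℝ) (hJ : IsUnit J.det) (V : Matrix ι ρ ℝ) (e E : ℕ) (δ : ρ → ℕ)
    (he : e ≤ E) (hδ : ∀ j, δ j ≤ E) {x : ℝ} (hx : x ≠ 0) :
    x ^ (E * Fintype.card ρ) * (x ^ e • J + V * Matrix.diagonal (fun j => x ^ δ j) * Vᵀ).det
      = J.det * x ^ (e * Fintype.card ι + ∑ j, δ j) *
        (Matrix.diagonal (fun j => x ^ (E - δ j)) + x ^ (E - e) • (Vᵀ * J⁻¹ * V)).det := by
  set D : Matrix ρ ρ ℝ := Matrix.diagonal (fun j => x ^ δ j) with hD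
  set Dh : Matrix ρ ρ ℝ := Matrix.diagonal (fun j => x ^ (E - δ j)) with hDh
  set C : Matrix ρ ρ ℝ := Vᵀ * J⁻¹ * V with hC
  -- (a) factor out the pivot
  have ha : x ^ e • J + V * D * Vᵀ = J * (x ^ e • (1 : Matrix ι ι ℝ) + (J⁻¹ * V * D) * Vᵀ) := by
    rw [Matrix.mul_add, Matrix.mul_smul, Matrix.mul_one]
    simp only [← Matrix.mul_assoc]
    rw [Matrix.mul_nonsing_inv _ hJ, Matrix.one_mul]
  -- (b) scaled Sylvester
  have hb : (x ^ e) ^ Fintype.card ρ * (x ^ e • (1 : Matrix ι ι ℝ) + (J⁻¹ * V * D) * Vᵀ).det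
      = (x ^ e) ^ Fintype.card ι * (x ^ e • (1 : Matrix ρ ρ ℝ) + C * D).det := by
    rw [sylvester_scaled (J⁻¹ * V * D) Vᵀ (pow_ne_zero _ hx), hC]
    simp only [Matrix.mul_assoc]
  -- (c) the dual word times `D`
  have hDD : Dh * D = x ^ E • (1 : Matrix ρ ρ ℝ) := by
    rw [hDh, hD, Matrix.diagonal_mul_diagonal, ← Matrix.diagonal_one, ← Matrix.diagonal_smul]
    congr 1
    funext j
    rw [Pi.smul_apply, smul_eq_mul, mul_one, ← pow_add, Nat.sub_add_cancel (hδ j)]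
  have hc : (Dh + x ^ (E - e) • C) * D = x ^ (E - e) • (x ^ e • (1 : Matrix ρ ρ ℝ) + C * D) := by
    rw [Matrix.add_mul, Matrix.smul_mul, hDD, smul_add, smul_smul, ← pow_add, Nat.sub_add_cancel he]
  have hc' : (Dh + x ^ (E - e) • C).det * D.det
      = (x ^ (E - e)) ^ Fintype.card ρ * (x ^ e • (1 : Matrix ρ ρ ℝ) + C * D).det := by
    rw [← Matrix.det_mul, hc, Matrix.det_smul]
  -- (d) `det D`
  have hd : D.det = x ^ (∑ j, δ j) := by
    rw [hD, Matrix.det_diagonal, Finset.prod_pow_eq_pow_sum]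
  -- assemble
  have hpow1 : x ^ (E * Fintype.card ρ) = (x ^ (E - e)) ^ Fintype.card ρ * (x ^ e) ^ Fintype.card ρ := by
    rw [← mul_pow, ← pow_add, Nat.sub_add_cancel he, pow_mul]
  have hpow2 : x ^ (e * Fintype.card ι + ∑ j, δ j) = (x ^ e) ^ Fintype.card ι * x ^ (∑ j, δ j) := by
    rw [pow_add, pow_mul]
  rw [ha, Matrix.det_mul, hpow1, hpow2]
  linear_combination ((x ^ (E - e)) ^ Fintype.card ρ * J.det) * hb
    - (J.det * (x ^ e) ^ Fintype.card ι) * hc' + (J.det * (x ^ e) ^ Fintype.card ι * (Dh + x ^ (E - e) • C).det) * hd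

/-! ## §2  The duality in `ℝ[X]` -/

/-- Evaluating the primal word entrywise. -/
theorem eval_word (J : Matrix ι ι ℝ) (V : Matrix ι ρ ℝ) (e : ℕ) (δ : ρ → ℕ) (x : ℝ) :
    (Polynomial.evalRingHom x).mapMatrix (𝔽[e, J, V, δ])
      = x ^ e • J + V * Matrix.diagonal (fun j => x ^ δ j) * Vᵀ := by
  classical
  ext i k
  simp only [RingHom.mapMatrix_apply, Matrix.map_apply, Matrix.add_apply, Matrix.smul_apply, smul_eq_mul,
    Polynomial.coe_evalRingHom, Polynomial.eval_add, Polynomial.eval_mul, Polynomial.eval_pow,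
    Polynomial.eval_X, Polynomial.eval_C, Matrix.mul_apply, Matrix.diagonal_apply, Matrix.transpose_apply,
    Polynomial.eval_finsetSum, mul_ite, mul_zero, Finset.sum_ite_eq', Finset.mem_univ, if_true]

/-- Evaluating the dual word entrywise. -/
theorem eval_dual (J : Matrix ι ι ℝ) (V : Matrix ι ρ ℝ) (E e : ℕ) (δ : ρ → ℕ) (x : ℝ) :
    (Polynomial.evalRingHom x).mapMatrix (𝔻[E, e, J, V, δ])
      = Matrix.diagonal (fun j => x ^ (E - δ j)) + x ^ (E - e) • (Vᵀ * J⁻¹ * V) := by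
  ext i k
  simp only [RingHom.mapMatrix_apply, Matrix.map_apply, Matrix.add_apply, Matrix.smul_apply, smul_eq_mul,
    Polynomial.coe_evalRingHom, Polynomial.eval_add, Polynomial.eval_mul, Polynomial.eval_pow,
    Polynomial.eval_X, Polynomial.eval_C, Matrix.diagonal_apply, apply_ite (Polynomial.eval x),
    Polynomial.eval_zero]

/-- `det` of the primal word, evaluated. -/
theorem eval_det_word (J : Matrix ι ι ℝ) (V : Matrix ι ρ ℝ) (e : ℕ) (δ : ρ → ℕ) (x : ℝ) :
    (Matrix.det (𝔽[e, J, V, δ])).eval x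
      = (x ^ e • J + V * Matrix.diagonal (fun j => x ^ δ j) * Vᵀ).det := by
  classical
  have h := RingHom.map_det (Polynomial.evalRingHom x) (𝔽[e, J, V, δ])
  rw [Polynomial.coe_evalRingHom] at h
  rw [h, eval_word]

/-- `det` of the dual word, evaluated. -/
theorem eval_det_dual (J : Matrix ι ι ℝ) (V : Matrix ι ρ ℝ) (E e : ℕ) (δ : ρ → ℕ) (x : ℝ) :
    (Matrix.det (𝔻[E, e, J, V, δ])).eval x
      = (Matrix.diagonal (fun j => x ^ (E - δ j)) + x ^ (E - e) • (Vᵀ * J⁻¹ * V)).det := by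
  have h := RingHom.map_det (Polynomial.evalRingHom x) (𝔻[E, e, J, V, δ])
  rw [Polynomial.coe_evalRingHom] at h
  rw [h, eval_dual]

/-- **THE GRAM DUALITY (polynomial identity).**  For every real `J` with `det J ≠ 0`, every real `V : ι × ρ`,
all exponents `e, δ j ≤ E`:
`X^{E·card ρ} · det (X^e J + V diag(X^δ) Vᵀ) = C(det J) · X^{e·card ι + Σδ} · det (diag(X^{E−δ}) + X^{E−e}·VᵀJ⁻¹V)`.
[folklore] (Sylvester's determinant identity, lacunary-pencil form) -/
theorem X_pow_mul_det_word (J : Matrix ι ι ℝ) (hJ : IsUnit J.det) (V : Matrix ι ρ ℝ) (e E : ℕ)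
    (δ : ρ → ℕ) (he : e ≤ E) (hδ : ∀ j, δ j ≤ E) :
    (Polynomial.X : Polynomial ℝ) ^ (E * Fintype.card ρ) * Matrix.det (𝔽[e, J, V, δ])
      = Polynomial.C J.det * (Polynomial.X : Polynomial ℝ) ^ (e * Fintype.card ι + ∑ j, δ j)
          * Matrix.det (𝔻[E, e, J, V, δ]) := by
  apply Polynomial.eq_of_infinite_eval_eq
  refine Set.Infinite.mono (s := {x : ℝ | x ≠ 0}) (fun x hx => ?_)
    ((Set.finite_singleton (0 : ℝ)).infinite_compl.mono fun x hx => by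
      simpa [Set.mem_compl_iff, Set.mem_singleton_iff] using hx)
  simp only [Set.mem_setOf_eq] at hx ⊢
  rw [Polynomial.eval_mul, Polynomial.eval_pow, Polynomial.eval_X, eval_det_word, Polynomial.eval_mul,
    Polynomial.eval_mul, Polynomial.eval_C, Polynomial.eval_pow, Polynomial.eval_X, eval_det_dual]
  exact det_word_mul_eq J hJ V e E δ he hδ hx

/-- **The two determinants vanish identically together.** [folklore] -/
theorem det_word_eq_zero_iff (J : Matrix ι ι ℝ) (hJ : IsUnit J.det) (V : Matrix ι ρ ℝ) (e E : ℕ)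
    (δ : ρ → ℕ) (he : e ≤ E) (hδ : ∀ j, δ j ≤ E) :
    Matrix.det (𝔽[e, J, V, δ]) = 0 ↔ Matrix.det (𝔻[E, e, J, V, δ]) = 0 := by
  have h := X_pow_mul_det_word J hJ V e E δ he hδ
  have hX : ∀ n : ℕ, (Polynomial.X : Polynomial ℝ) ^ n ≠ 0 := fun n => pow_ne_zero _ Polynomial.X_ne_zero
  have hCJ : Polynomial.C J.det ≠ 0 := by
    rw [Ne, Polynomial.C_eq_zero]; exact hJ.ne_zero
  constructor
  · intro h0
    rw [h0, mul_zero] at h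
    rcases mul_eq_zero.1 h.symm with h1 | h1
    · rcases mul_eq_zero.1 h1 with h2 | h2
      · exact absurd h2 hCJ
      · exact absurd h2 (hX _)
    · exact h1
  · intro h0
    rw [h0, mul_zero] at h
    rcases mul_eq_zero.1 h with h1 | h1
    · exact absurd h1 (hX _)
    · exact h1

/-- **Same vanishing at every non-zero scale.** [folklore] -/
theorem eval_det_word_eq_zero_iff (J : Matrix ι ι ℝ) (hJ : IsUnit J.det) (V : Matrix ι ρ ℝ) (e E : ℕ)
    (δ : ρ → ℕ) (he : e ≤ E) (hδ : ∀ j, δ j ≤ E) {x : ℝ} (hx : x ≠ 0) :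
    (Matrix.det (𝔽[e, J, V, δ])).eval x = 0 ↔ (Matrix.det (𝔻[E, e, J, V, δ])).eval x = 0 := by
  have h := det_word_mul_eq J hJ V e E δ he hδ hx
  rw [eval_det_word, eval_det_dual]
  have h1 : x ^ (E * Fintype.card ρ) ≠ 0 := pow_ne_zero _ hx
  have h2 : J.det * x ^ (e * Fintype.card ι + ∑ j, δ j) ≠ 0 := mul_ne_zero hJ.ne_zero (pow_ne_zero _ hx)
  constructor
  · intro h0
    rw [h0, mul_zero] at h
    exact (mul_eq_zero.1 h.symm).resolve_left h2
  · intro h0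
    rw [h0, mul_zero] at h
    exact (mul_eq_zero.1 h).resolve_left h1

/-- **The non-zero real zeros coincide.** [folklore] -/
theorem nonzeroRoots_word_eq (J : Matrix ι ι ℝ) (hJ : IsUnit J.det) (V : Matrix ι ρ ℝ) (e E : ℕ)
    (δ : ρ → ℕ) (he : e ≤ E) (hδ : ∀ j, δ j ≤ E) :
    (Matrix.det (𝔽[e, J, V, δ])).roots.toFinset.filter (fun t => t ≠ 0)
      = (Matrix.det (𝔻[E, e, J, V, δ])).roots.toFinset.filter (fun t => t ≠ 0) := by
  ext t
  simp only [Finset.mem_filter, Multiset.mem_toFinset, Polynomial.mem_roots', Polynomial.IsRoot.def]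
  constructor
  · rintro ⟨⟨hne, hev⟩, ht⟩
    exact ⟨⟨fun h0 => hne ((det_word_eq_zero_iff J hJ V e E δ he hδ).2 h0),
      (eval_det_word_eq_zero_iff J hJ V e E δ he hδ ht).1 hev⟩, ht⟩
  · rintro ⟨⟨hne, hev⟩, ht⟩
    exact ⟨⟨fun h0 => hne ((det_word_eq_zero_iff J hJ V e E δ he hδ).1 h0),
      (eval_det_word_eq_zero_iff J hJ V e E δ he hδ ht).2 hev⟩, ht⟩

/-- **The positive zeros coincide** (the crux's currency). [folklore] -/
theorem posRoots_word_eq (J : Matrix ι ι ℝ) (hJ : IsUnit J.det) (V : Matrix ι ρ ℝ) (e E : ℕ)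
    (δ : ρ → ℕ) (he : e ≤ E) (hδ : ∀ j, δ j ≤ E) :
    (Matrix.det (𝔽[e, J, V, δ])).roots.toFinset.filter (fun t => 0 < t)
      = (Matrix.det (𝔻[E, e, J, V, δ])).roots.toFinset.filter (fun t => 0 < t) := by
  ext t
  simp only [Finset.mem_filter, Multiset.mem_toFinset, Polynomial.mem_roots', Polynomial.IsRoot.def]
  constructor
  · rintro ⟨⟨hne, hev⟩, ht⟩
    exact ⟨⟨fun h0 => hne ((det_word_eq_zero_iff J hJ V e E δ he hδ).2 h0),
      (eval_det_word_eq_zero_iff J hJ V e E δ he hδ ht.ne').1 hev⟩, ht⟩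
  · rintro ⟨⟨hne, hev⟩, ht⟩
    exact ⟨⟨fun h0 => hne ((det_word_eq_zero_iff J hJ V e E δ he hδ).1 h0),
      (eval_det_word_eq_zero_iff J hJ V e E δ he hδ ht.ne').2 hev⟩, ht⟩

/-- **`Z₊(primal) = Z₊(dual)`**: the number of distinct positive zeros of `det (X^e J + V diag(X^δ) Vᵀ)`
(size `card ι`) equals that of the dual word (size `card ρ`). [folklore] -/
theorem card_posRoots_word_eq (J : Matrix ι ι ℝ) (hJ : IsUnit J.det) (V : Matrix ι ρ ℝ) (e E : ℕ)
    (δ : ρ → ℕ) (he : e ≤ E) (hδ : ∀ j, δ j ≤ E) :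
    ((Matrix.det (𝔽[e, J, V, δ])).roots.toFinset.filter (fun t => 0 < t)).card
      = ((Matrix.det (𝔻[E, e, J, V, δ])).roots.toFinset.filter (fun t => 0 < t)).card := by
  rw [posRoots_word_eq J hJ V e E δ he hδ]

/-! ## §3  First consequence: `J⁻¹`-null letter systems carry no positive zero -/

/-- **NULL LETTER SYSTEMS.**  If the Gram matrix vanishes, `VᵀJ⁻¹V = 0` (every letter column is
`J⁻¹`-isotropic and the columns are pairwise `J⁻¹`-orthogonal), then `det (X^e J + V diag(X^δ) Vᵀ)` has NO
positive zero — whatever the exponents and on whichever sides of the pivot they lie. [folklore] -/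
theorem posRoots_eq_empty_of_gram_eq_zero (J : Matrix ι ι ℝ) (hJ : IsUnit J.det) (V : Matrix ι ρ ℝ) (e : ℕ)
    (δ : ρ → ℕ) (hC : Vᵀ * J⁻¹ * V = 0) :
    (Matrix.det (𝔽[e, J, V, δ])).roots.toFinset.filter (fun t => 0 < t) = ∅ := by
  classical
  -- a common exponent bound
  set E : ℕ := e + ∑ j, δ j with hE
  have he : e ≤ E := Nat.le_add_right _ _
  have hδ : ∀ j, δ j ≤ E := fun j =>
    (Finset.single_le_sum (f := δ) (fun i _ => Nat.zero_le _) (Finset.mem_univ j)).trans (Nat.le_add_left _ _)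
  rw [posRoots_word_eq J hJ V e E δ he hδ, Finset.filter_eq_empty_iff]
  intro t ht hpos
  rw [Multiset.mem_toFinset, Polynomial.mem_roots', Polynomial.IsRoot.def, eval_det_dual] at ht
  obtain ⟨-, hev⟩ := ht
  rw [hC, smul_zero, add_zero, Matrix.det_diagonal] at hev
  exact absurd hev (Finset.prod_ne_zero_iff.2 fun j _ => pow_ne_zero _ hpos.ne')

end GramDual

end Summit.ValiantsHypothesis.ValiantsHypothesis.Theorems.LacunarySymmetroidMatrixDescartes
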